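import Mathlib
import Literature.AlgebraicGeometry.Resolution.SeparablyDefectlessDenseDescent
import Literature.AlgebraicGeometry.Resolution.DefectAmbient
import Literature.AlgebraicGeometry.Resolution.FundamentalInequality
import Literature.AlgebraicGeometry.Resolution.ValuationDefect
import HarnessLib

/-!
# Dense extensions of defectless fields are linearly disjoint from `F₀^{1/p}` (`stub_linDisjoint_of_dense_defectless`)

Stub of the birth line of the crux `ShadowsUniformize` (route `AbhyankarShadows`), branch
`lurelDenseAbhyankar` (Knaf–Kuhlmann 2009, Thm. 1.5: rational places in the completion of an
Abhyankar subfunction field `F₀`). Knaf–Kuhlmann 2009, **Lemma 3.12** ("every immediate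
extension of a defectless field is separable") is what makes `K' | F₀` separably generated; this
file proves its valuation-theoretic heart in the form consumed by Mac Lane's criterion
(`stub_separablyGenerated_of_linDisjoint`): `K'` is linearly disjoint over `F₀` from every
`F₀(d₁, …, dₙ)` with `dᵢᵖ ∈ F₀`.

Setting (ambient rendering of `ValuedFunctionFields.lean`): one valued field `(Ω, V)` of
characteristic `p`, subfields `F₀ ≤ K'` of `Ω` with `F₀` DENSE in `K'` (`IsDenseIn`) and
`(F₀, V ∩ F₀)` a defectless field (`IsDefectlessField`).

Claim: if `d₁, …, dₙ ∈ Ω` have `dᵢᵖ ∈ F₀`, `s₁, …, sₙ ∈ K'` are `F₀`-linearly independent and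
`∑ dᵢ sᵢ = 0`, then all `dᵢ = 0`.

Proof. `L = F₀(d)` is finite over `F₀` and every `z ∈ L` has `zᵖ ∈ F₀`, so `V ∩ L` is the ONLY
extension of `V ∩ F₀` to `L` (`z ∈ O' ↔ zᵖ ∈ O'`); defectlessness gives `e · f = [L : F₀]` with
`e = (vL : vF₀)`, `f = [Lv : F₀v]` (ambient bridges `ramificationIndex_comap_eq_relIndex`,
`inertiaDegree_comap_eq_relfinrank`). Pick `a₁, …, aₑ ∈ L` representing the cosets of `vF₀` in
`vL` and `b₁, …, b_f ∈ L ∩ V` lifting a basis of `Lv | F₀v`. Density makes `vK' = vF₀` and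
`K'v = F₀v`, so the fundamental inequality (`linearIndependent_mul_of_valuation_of_residue` with
ground field `K'`) shows that the `e·f` products `aᵢ bⱼ` are `K'`-linearly independent; a
fortiori they are `F₀`-linearly independent, hence an `F₀`-basis of `L` by the count. Expanding
`dᵢ = ∑_q φᵢq w_q` in this basis, `0 = ∑ᵢ dᵢ sᵢ = ∑_q (∑ᵢ φᵢq sᵢ) w_q` with coefficients in
`K'`, so `∑ᵢ φᵢq sᵢ = 0` for every `q`, so `φᵢq = 0` by the independence of the `sᵢ`, so
`dᵢ = 0`.
-/

noncomputable section

-- single-problem summit: the doubled namespace component is forced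
set_option linter.dupNamespace false

open Literature.AlgebraicGeometry.Resolution IsLocalRing

namespace Summit.ResolutionOfSingularities.ResolutionOfSingularities.Theorems

/-- An element lies in a valuation ring iff some (any) positive power does. [folklore] -/
theorem pow_mem_valuationSubring_iff {K : Type*} [Field K] (O : ValuationSubring K) {x : K}
    {n : ℕ} (hn : n ≠ 0) : x ^ n ∈ O ↔ x ∈ O := by
  rw [← O.valuation_le_one_iff, ← O.valuation_le_one_iff, map_pow]
  exact pow_le_one_iff hn

/-- For subfields `A ≤ B` of a field `Φ`, the relative degree `[B : A]` (`Subfield.relfinrank`)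
is the `A`-dimension of `B` regarded as an `A`-submodule of `Φ` (`B` is its own `A`-span).
[folklore] -/
theorem relfinrank_eq_finrank_span {Φ : Type*} [Field Φ] {A B : Subfield Φ} (h : A ≤ B) :
    A.relfinrank B = Module.finrank A ↥(Submodule.span A (B : Set Φ)) := by
  have hspan : Submodule.span A (B : Set Φ) =
      Subalgebra.toSubmodule (Subfield.extendScalars h).toSubalgebra := by
    rw [← Subfield.coe_extendScalars h, ← IntermediateField.coe_toSubalgebra,
      ← Subalgebra.coe_toSubmodule, Submodule.span_eq]
  rw [Subfield.relfinrank_eq_finrank_of_le h, hspan]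
  rfl

/-- **Knaf–Kuhlmann 2009, Lemma 3.12 (valuation-theoretic heart).** Let `(Ω, V)` be a valued
field of characteristic `p` and `F₀ ≤ K'` subfields with `F₀` dense in `K'` and `(F₀, V ∩ F₀)`
defectless. If `dᵢᵖ ∈ F₀`, `sᵢ ∈ K'` are `F₀`-linearly independent and `∑ dᵢ sᵢ = 0`, then all
`dᵢ = 0`: a dense extension of a defectless field is linearly disjoint from the purely
inseparable extensions of exponent one. [cite: KnafKuhlmann2009, Lemma 3.12] -/
theorem stub_linDisjoint_of_dense_defectless {Ω : Type} [Field Ω] [IsAlgClosed Ω]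
    (V : ValuationSubring Ω) (p : ℕ) [Fact p.Prime] [CharP Ω p] (F₀ K' : Subfield Ω)
    (hle : F₀ ≤ K') (hdense : IsDenseIn V F₀ K')
    (hdef : IsDefectlessField F₀ (V.comap (algebraMap F₀ Ω)))
    (n : ℕ) (d s : Fin n → Ω) (hd : ∀ i, d i ^ p ∈ F₀) (hs : ∀ i, s i ∈ K')
    (hsi : LinearIndependent F₀ s) (hsum : ∑ i, d i * s i = 0) : ∀ i, d i = 0 := by
  classical
  have hp : p.Prime := Fact.out
  -- (1) `L = F₀(d)`: finite over `F₀`, and `zᵖ ∈ F₀` for every `z ∈ L`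
  set L : IntermediateField F₀ Ω := IntermediateField.adjoin F₀ (Set.range d)
  have hdL : ∀ i, d i ∈ L := fun i => IntermediateField.subset_adjoin F₀ _ ⟨i, rfl⟩
  haveI hLfin : FiniteDimensional F₀ L := by
    refine IntermediateField.finiteDimensional_adjoin fun x hx => ?_
    obtain ⟨i, rfl⟩ := hx
    refine IsIntegral.of_pow hp.pos ?_
    rw [show d i ^ p = algebraMap F₀ Ω ⟨d i ^ p, hd i⟩ from rfl]
    exact isIntegral_algebraMap
  have hLp : ∀ z : Ω, z ∈ L → z ^ p ∈ F₀ := by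
    intro z hz
    induction hz using IntermediateField.adjoin_induction with
    | mem x hx =>
      obtain ⟨i, rfl⟩ := hx
      exact hd i
    | algebraMap c => exact F₀.pow_mem c.2 p
    | add x y _ _ hx hy =>
      rw [add_pow_char]
      exact F₀.add_mem hx hy
    | inv x _ hx =>
      rw [inv_pow]
      exact F₀.inv_mem hx
    | mul x y _ _ hx hy =>
      rw [mul_pow]
      exact F₀.mul_mem hx hy
  -- (2) `V ∩ L` is the only extension of `V ∩ F₀` to `L`, so `e · f = [L : F₀]`
  have hW : (V.comap (algebraMap L Ω)).comap (algebraMap F₀ L) = V.comap (algebraMap F₀ Ω) := by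
    rw [ValuationSubring.comap_comap, ← IsScalarTower.algebraMap_eq]
  have huniq : ∀ O' : ValuationSubring L,
      O'.comap (algebraMap F₀ L) = V.comap (algebraMap F₀ Ω) → O' = V.comap (algebraMap L Ω) := by
    intro O' hO'
    ext z
    have hc : (z : Ω) ^ p ∈ F₀ := hLp z z.2
    have hzp : z ^ p = algebraMap F₀ L ⟨(z : Ω) ^ p, hc⟩ :=
      Subtype.ext (by rw [IntermediateField.coe_pow]; rfl)
    calc z ∈ O' ↔ z ^ p ∈ O' := (pow_mem_valuationSubring_iff O' hp.ne_zero).symm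
      _ ↔ (⟨(z : Ω) ^ p, hc⟩ : F₀) ∈ O'.comap (algebraMap F₀ L) := by
          rw [hzp, ValuationSubring.mem_comap]
      _ ↔ (⟨(z : Ω) ^ p, hc⟩ : F₀) ∈ (V.comap (algebraMap L Ω)).comap (algebraMap F₀ L) := by
          rw [hO', hW]
      _ ↔ z ^ p ∈ V.comap (algebraMap L Ω) := by rw [hzp, ValuationSubring.mem_comap]
      _ ↔ z ∈ V.comap (algebraMap L Ω) := pow_mem_valuationSubring_iff _ hp.ne_zero
  obtain ⟨S, hS, hsumS⟩ := hdef L hLfin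
  have hS1 : S = {V.comap (algebraMap L Ω)} :=
    Finset.eq_singleton_iff_unique_mem.mpr
      ⟨(hS _).mpr hW, fun O' hO' => huniq O' ((hS O').mp hO')⟩
  have hR : residueSubfield F₀ V ≤ residueSubfield L V := residueSubfield_le_residueSubfield F₀ L V
  rw [hS1, Finset.sum_singleton, ramificationIndex_comap_eq_relIndex,
    inertiaDegree_comap_eq_relfinrank, relfinrank_eq_finrank_span hR] at hsumS
  -- `e` := the number of cosets of `vF₀` in `vL`, `f := [Lv : F₀v]`; `e · f = [L : F₀] > 0`
  generalize hG : valueSubgroup L V = G at hsumS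
  have hprod : Nat.card (G ⧸ (valueSubgroup F₀ V).subgroupOf G) *
      Module.finrank (residueSubfield F₀ V)
        ↥(Submodule.span (residueSubfield F₀ V) (residueSubfield L V : Set (ResidueField V))) =
      Module.finrank F₀ L := hsumS
  have hpos : 0 < Module.finrank F₀ L := Module.finrank_pos
  have he0 : Nat.card (G ⧸ (valueSubgroup F₀ V).subgroupOf G) ≠ 0 := fun h =>
    hpos.ne' (by rw [← hprod, h, zero_mul])
  have hf0 : Module.finrank (residueSubfield F₀ V)
      ↥(Submodule.span (residueSubfield F₀ V) (residueSubfield L V : Set (ResidueField V))) ≠ 0 :=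
    fun h => hpos.ne' (by rw [← hprod, h, mul_zero])
  haveI : Module.Finite (residueSubfield F₀ V)
      ↥(Submodule.span (residueSubfield F₀ V) (residueSubfield L V : Set (ResidueField V))) :=
    Module.finite_of_finrank_pos (Nat.pos_of_ne_zero hf0)
  -- (3) representatives `a i ∈ L` of the cosets of `vF₀` in `vL`; lifts `b j ∈ L ∩ V` of an
  -- `F₀v`-linearly independent family of `f` elements of `Lv`
  obtain ⟨r, hrR, -, hrli⟩ := Submodule.exists_fun_fin_finrank_span_eq (residueSubfield F₀ V)
    (residueSubfield L V : Set (ResidueField V))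
  obtain ⟨eQ⟩ : Nonempty ((G ⧸ (valueSubgroup F₀ V).subgroupOf G) ≃
      Fin (Nat.card (G ⧸ (valueSubgroup F₀ V).subgroupOf G))) := ⟨Nat.equivFinOfCardPos he0⟩
  have hexa : ∀ q : G ⧸ (valueSubgroup F₀ V).subgroupOf G, ∃ c : L, c ≠ 0 ∧
      (((q.out : ↥G) : (V.ValueGroup)ˣ) : V.ValueGroup) = V.valuation (algebraMap L Ω c) :=
    fun q => (mem_valueSubgroup_iff L V _).mp (hG ▸ q.out.2)
  choose cA hcA0 hcAv using hexa
  have hexb : ∀ j, ∃ (c : L) (h : algebraMap L Ω c ∈ V),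
      residue V ⟨algebraMap L Ω c, h⟩ = r j :=
    fun j => (mem_residueSubfield_iff L V _).mp (hrR j)
  choose cB hcBV hcBres using hexb
  obtain ⟨a, haL, ha0, hav⟩ : ∃ a : Fin (Nat.card (G ⧸ (valueSubgroup F₀ V).subgroupOf G)) → Ω,
      (∀ i, a i ∈ L) ∧ (∀ i, a i ≠ 0) ∧
        ∀ i, V.valuation (a i) = (((eQ.symm i).out : ↥G) : (V.ValueGroup)ˣ) :=
    ⟨fun i => (cA (eQ.symm i) : Ω), fun i => (cA _).2, fun i h => hcA0 _ (Subtype.ext h),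
      fun i => (hcAv _).symm⟩
  obtain ⟨b, hbL, hbres⟩ : ∃ b : Fin _ → V,
      (∀ j, (b j : Ω) ∈ L) ∧ ∀ j, residue V (b j) = r j :=
    ⟨fun j => ⟨algebraMap L Ω (cB j), hcBV j⟩, fun j => (cB j).2, hcBres⟩
  -- (4) density: `vK' ⊆ vF₀` and `K'v ⊆ F₀v`; the fundamental inequality over `K'`
  have hHK : ∀ c : Ω, c ∈ K' → (hc : c ≠ 0) →
      Units.mk0 (V.valuation c) ((Valuation.ne_zero_iff _).mpr hc) ∈ valueSubgroup F₀ V := by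
    intro c hcK hc0
    obtain ⟨z, hzF, -, hz⟩ := hdense.exists_valuation_eq hcK hc0
    have hz0 : (⟨z, hzF⟩ : F₀) ≠ 0 := by
      intro h
      have h' : z = 0 := congrArg Subtype.val h
      rw [h', map_zero] at hz
      exact (Valuation.ne_zero_iff _).mpr hc0 hz.symm
    exact (mem_valueSubgroup_iff F₀ V _).mpr ⟨⟨z, hzF⟩, hz0, hz.symm⟩
  have hLK : ∀ c : Ω, c ∈ K' → (hc : c ∈ V) → residue V ⟨c, hc⟩ ∈ residueSubfield F₀ V := by
    intro c hcK hcV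
    obtain ⟨z, hzF, hz⟩ := hdense c hcK 1 K'.one_mem one_ne_zero
    rw [map_one] at hz
    have hzV : z ∈ V := by
      have h : z = c - (c - z) := by ring
      rw [h]
      exact V.sub_mem hcV ((V.valuation_le_one_iff _).mp hz.le)
    refine (mem_residueSubfield_iff F₀ V _).mpr ⟨⟨z, hzF⟩, hzV, ?_⟩
    have hsub : residue V (⟨c, hcV⟩ - ⟨z, hzV⟩) = 0 := by
      rw [residue_eq_zero_iff, ValuationSubring.valuation_lt_one_iff]
      exact hz
    rw [map_sub, sub_eq_zero] at hsub
    exact hsub.symm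
  have hdist : ∀ i i', i ≠ i' →
      (Units.mk0 (V.valuation (a i)) ((Valuation.ne_zero_iff _).mpr (ha0 i)))⁻¹ *
        Units.mk0 (V.valuation (a i')) ((Valuation.ne_zero_iff _).mpr (ha0 i')) ∉
        valueSubgroup F₀ V := by
    intro i i' hii' hmem
    have hmk : ∀ i, Units.mk0 (V.valuation (a i)) ((Valuation.ne_zero_iff _).mpr (ha0 i)) =
        (((eQ.symm i).out : ↥G) : (V.ValueGroup)ˣ) := fun i => Units.ext (hav i)
    rw [hmk, hmk, ← Subgroup.coe_inv, ← Subgroup.coe_mul, ← Subgroup.mem_subgroupOf] at hmem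
    apply hii'
    apply eQ.symm.injective
    rw [← QuotientGroup.out_eq' (eQ.symm i), ← QuotientGroup.out_eq' (eQ.symm i')]
    exact QuotientGroup.eq.mpr hmem
  have hb : LinearIndependent (residueSubfield F₀ V) fun j => residue V (b j) := by
    rw [show (fun j => residue V (b j)) = r from funext hbres]
    exact hrli
  have hwK := linearIndependent_mul_of_valuation_of_residue V K' (valueSubgroup F₀ V) hHK
    (residueSubfield F₀ V) hLK a ha0 hdist b hb
  -- (5) the `e·f = [L : F₀]` products `a i * b j` are thus an `F₀`-basis of `L`
  obtain ⟨w, hw⟩ : ∃ w : Fin (Nat.card (G ⧸ (valueSubgroup F₀ V).subgroupOf G)) × Fin _ → L,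
      ∀ q, (w q : Ω) = a q.1 * (b q.2 : Ω) :=
    ⟨fun q => ⟨a q.1, haL q.1⟩ * ⟨(b q.2 : Ω), hbL q.2⟩, fun q => rfl⟩
  have hwF : LinearIndependent F₀ w := by
    rw [Fintype.linearIndependent_iff]
    intro g hg q
    have h := Fintype.linearIndependent_iff.mp hwK (fun q => ⟨(g q : Ω), hle (g q).2⟩) ?_ q
    · have h' : ((g q : F₀) : Ω) = 0 := Subtype.ext_iff.mp h
      exact Subtype.ext h'
    · have h2 := congrArg (algebraMap L Ω) hg
      rw [map_sum, map_zero] at h2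
      rw [← h2]
      refine Finset.sum_congr rfl fun q _ => ?_
      rw [Algebra.smul_def (g q) (w q), map_mul, IntermediateField.algebraMap_apply,
        IntermediateField.algebraMap_apply, hw q]
      rfl
  have hspan := hwF.span_eq_top_of_card_eq_finrank'
    (by rw [Fintype.card_prod, Fintype.card_fin, Fintype.card_fin]; exact hprod)
  -- (6) expand the `d i` in this basis and compare coefficients
  have hmem : ∀ i, (⟨d i, hdL i⟩ : L) ∈ Submodule.span F₀ (Set.range w) := fun i =>
    hspan ▸ Submodule.mem_top
  have hmem' : ∀ i, ∃ c : _ → F₀, ∑ q, c q • w q = (⟨d i, hdL i⟩ : L) := fun i =>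
    (Submodule.mem_span_range_iff_exists_fun F₀).mp (hmem i)
  choose φ hφ using hmem'
  have hdi : ∀ i, d i = ∑ q, ((φ i q : F₀) : Ω) * (a q.1 * (b q.2 : Ω)) := by
    intro i
    have h := congrArg (algebraMap L Ω) (hφ i)
    rw [map_sum] at h
    refine h.symm.trans (Finset.sum_congr rfl fun q _ => ?_)
    rw [Algebra.smul_def (φ i q) (w q), map_mul, IntermediateField.algebraMap_apply,
      IntermediateField.algebraMap_apply, hw q]
    rfl
  have key : ∑ q, (∑ i, ((φ i q : F₀) : Ω) * s i) * (a q.1 * (b q.2 : Ω)) = 0 := by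
    rw [← hsum]
    simp_rw [Finset.sum_mul]
    rw [Finset.sum_comm]
    refine Finset.sum_congr rfl fun i _ => ?_
    rw [hdi i, Finset.sum_mul]
    exact Finset.sum_congr rfl fun q _ => by ring
  have ht : ∀ q, ∑ i, ((φ i q : F₀) : Ω) * s i = 0 := by
    intro q
    have h := Fintype.linearIndependent_iff.mp hwK
      (fun q => ⟨∑ i, ((φ i q : F₀) : Ω) * s i,
        K'.sum_mem fun i _ => K'.mul_mem (hle (φ i q).2) (hs i)⟩) key q
    exact Subtype.ext_iff.mp h
  have hφ0 : ∀ i q, φ i q = 0 := fun i q =>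
    Fintype.linearIndependent_iff.mp hsi (fun i => φ i q) (ht q) i
  intro i
  have h0 : (⟨d i, hdL i⟩ : L) = 0 := by
    rw [← hφ i]
    exact Finset.sum_eq_zero fun q _ => by rw [hφ0 i q, zero_smul]
  exact congrArg Subtype.val h0

end Summit.ResolutionOfSingularities.ResolutionOfSingularities.Theorems

end
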